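import Summits.BirchSwinnertonDyer.BirchSwinnertonDyer.Theorems.GenusKolyvaginAtTwoMinimalTwinBSDTwoAllDepthCells
import Summits.BirchSwinnertonDyer.BirchSwinnertonDyer.Theses.ByReductionTypeAtTwo
import HarnessLib

/-!
# Route `GenusKolyvaginAtTwo`, crux U₂ `MinimalTwinBSDTwo` (stmt-BirchSwinnertonDyer-22985): THE ITEM LEDGER AT ALL DEPTHS —
# modulo EXISTING ITEMS (wall 19095–19098, rank-0 2-converse 19218/19219, S_id 32821, the print items) + one declared converse residual + the
# 2-adic exponent of `y_K` (EXP±_all), **U₂ is EQUIVALENT to its `Δ > 0` residual OFF′**; its whole `Δ < 0` half follows outright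

Seat `bsd-line-gk2-p2` g25 (PROVER seat 2/3, cell `bsd-f1-sign2`; LINE 23 holder), `--supports stmt-BirchSwinnertonDyer-22985` (helper; closes
nothing).  THEOREMS ONLY (no definition, no named fact, no `sorry`); standard axioms.  **BSD is NOT proved by this file; U₂, the wall, the
converses, EXP, S_id are NOT proved; no item is closed.**  Every theorem is CONDITIONAL on its displayed hypotheses, ALL of which are either route
ITEMS by name (`Theses.ByReductionTypeAtTwo.{GoodOrdinary,Multiplicative,Supersingular,Additive}RankZeroAtTwo`, `…RankOneAtTwoBigImageIdLocus`,
`Theses.TwoAdicConverse.{GoodOrdinary,Multiplicative}RankZeroTwoConverse`, `Theses.GenusKolyvaginAtTwo.{GrossZagierAllLevels, MultPublishedInputsAtTwo,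
EntireLFunctionRat, MilneAnyModel}`), the Literature statement `nonempty_modularParametrizationData` (BCDT), the declared residual «rank-0 2-converse
off the semistable-ordinary locus at 2», or the exponent texts EXP⁻_all / EXP⁺_all (the BSD₂ content, lossless).  This is the Theorems-side record
of the LINE 23 v1.8 skeleton (`Cruxes/MinimalTwinBSDTwo/Lines/twin_swap.lean`), built on this seat's depth-free engines `…AllDepthCells` (p776404).

* §1 `minimalTwinBSDTwo_negDisc_of_items` — **the whole `Δ < 0` half of U₂** (every non-CM globally minimal `W` with `r_an = 1`, `#Sel₂ = 2`, `Δ < 0`;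
  ANY Tamagawa product, NO image hypothesis) ⟸ WALL + CONV₀ + EXP⁻_all + PRINT.
* §2 `minimalTwinBSDTwo_iff_offPrime_of_items` — modulo WALL + CONV₀ + EXP⁻_all + EXP⁺_all + S_id + PRINT: **`MinimalTwinBSDTwo ↔ OFF′`**, OFF′ :=
  «`Δ > 0` ∧ (`ρ̄_{W,2}` not onto ∨ (`¬MeetsEgg` ∧ ¬(`ord₂ C = 0` ∧ `ρ̄_{W,2ⁿ}` onto ∀ n)))» — the exact price of the item beyond named inputs.
References: [GrossZagier1986] V.§2; [MazurRubin2010] Prop. 3.3, Cor. 3.4 (i), Lemma 3.5; [Kramer1981] §2 Props. 3, 6; [McCallumLMS1991] §5 Lemma 5.1;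
[Milne1972ArithmeticAV] §1 Thm. 1; [Miller2011LMS] Def. 1.1.
-/

set_option autoImplicit false
set_option linter.dupNamespace false -- `Summit.<P>.<Sub>` repeats `BirchSwinnertonDyer` (D-0017)

noncomputable section

open scoped Classical NumberField

open WeierstrassCurve NumberField Literature.NumberTheory.EllipticCurves Literature.NumberTheory.EllipticCurves.ModularForms
  Literature.NumberTheory.EllipticCurves.Rank1Residual
  Summit.BirchSwinnertonDyer.Rank1Residual.F1Sign2
open Summit.BirchSwinnertonDyer.BirchSwinnertonDyer.Theses.GenusKolyvaginAtTwo
open Summit.BirchSwinnertonDyer.BirchSwinnertonDyer.Theses.ByReductionTypeAtTwo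
  (GoodOrdinaryRankZeroAtTwo MultiplicativeRankZeroAtTwo SupersingularRankZeroAtTwo AdditiveRankZeroAtTwo RankOneAtTwoBigImageIdLocus)
open Summit.BirchSwinnertonDyer.BirchSwinnertonDyer.Theses.TwoAdicConverse (GoodOrdinaryRankZeroTwoConverse MultiplicativeRankZeroTwoConverse)
open Summit.BirchSwinnertonDyer.BirchSwinnertonDyer.Theorems.GenusExact.TwinSwap.Ledger.Line25
  (hTw0idSharp_of_idLocus_of_GZK rankZeroTwoConverse_of_items_of_offSemistable)
open Summit.BirchSwinnertonDyer.BirchSwinnertonDyer.Theorems.GenusExact.TwinSwap.AllDepth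
  (bsdp_negDisc_of_wall_of_converse_of_exponent_of_facts bsdp_posDisc_egg_of_wall_of_converse_of_exponent_of_facts)

namespace Summit.BirchSwinnertonDyer.BirchSwinnertonDyer.Theorems.GenusExact.TwinSwap.AllDepth

/-! ## §0 The wall items give LINE 23's anchor S1 (reduction-type tetrachotomy at `2`) -/

/-- WALL row 1 (ByReductionTypeAtTwo items 19095–19098, BY NAME) ⟹ BSD₂ for every non-CM rank-`0` curve with `#Sel₂ = 1` (indeed for every
non-CM rank-`0` curve): tetrachotomy of the reduction type at `2`.  [folklore] -/
theorem minimalRankZeroBSDTwo_of_wallItems (hOrd : GoodOrdinaryRankZeroAtTwo) (hMult : MultiplicativeRankZeroAtTwo)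
    (hSS : SupersingularRankZeroAtTwo) (hAdd : AdditiveRankZeroAtTwo) :
    ∀ (W : WeierstrassCurve ℚ) [W.IsElliptic] [W.IsGloballyMinimal],
      ¬ W.HasCM → W.analyticRank = 0 → Nat.card (W.selmerGroup 2) = 1 → BSDp W 2 := by
  intro W _ _ hCM hr _hSel
  by_cases hg : W.HasGoodReductionAtPrime 2
  · by_cases hd : ((2 : ℕ) : ℤ) ∣ W.frobeniusTrace 2
    · exact hSS W hCM hr ⟨hg, hd⟩
    · exact hOrd W hCM hr ⟨hg, hd⟩
  · by_cases hm : W.HasMultiplicativeReductionAtPrime 2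
    · exact hMult W hCM hr hm
    · exact hAdd W hCM hr ⟨hg, hm⟩

/-! ## §1 The whole `Δ < 0` half of the item from items + EXP⁻_all -/

/-- **THE `Δ < 0` HALF OF U₂ ⟸ WALL + CONV₀ + EXP⁻_all + PRINT, all but EXP⁻_all NAMED ITEMS.**  For EVERY non-CM globally minimal `W` with
`r_an(W) = 1`, `#Sel₂(W) = 2` and `Δ_W < 0` (any Tamagawa product, no image hypothesis): `BSD₂(W)`, from the four WALL items (19095–19098), the two rank-0
2-converse items (19218, 19219) + the declared off-semistable converse residual, EXP⁻_all (the 2-adic exponent `2^{ord₂ c + ord₂ C(W)} ∥ P(1)` at every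
door-open prime Heegner field with `L(W^{(d_K)},1) ≠ 0` and every datum), and the print items (GZ 24148, GZK 19921, modularity 19273, Milne 24149) +
BCDT.  = `AllDepth.bsdp_negDisc_of_wall_of_converse_of_exponent_of_facts` (p776404) with every input by name.  CONDITIONAL on the displayed hypotheses;
proves nothing about BSD; closes nothing.  [cite: GrossZagier1986, V.§2 (2.2)] [cite: MazurRubin2010, Prop. 3.3, Cor. 3.4 (i), Lemma 3.5]
[cite: McCallumLMS1991, §5 Lemma 5.1] [cite: Miller2011LMS, Def. 1.1] -/
theorem minimalTwinBSDTwo_negDisc_of_items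
    (hOrd : GoodOrdinaryRankZeroAtTwo) (hMult : MultiplicativeRankZeroAtTwo) (hSS : SupersingularRankZeroAtTwo) (hAdd : AdditiveRankZeroAtTwo)
    (hC0g : GoodOrdinaryRankZeroTwoConverse) (hC0m : MultiplicativeRankZeroTwoConverse)
    (hC0r : ∀ (V : WeierstrassCurve ℚ) [V.IsElliptic] [V.IsGloballyMinimal], ¬ V.HasCM → ¬ (GoodOrd V 2 ∨ Mult V 2) →
      V.selmerCorank 2 = 0 → V.analyticRank = 0)
    (hEXPneg : ∀ (W : WeierstrassCurve ℚ) [W.IsElliptic] [W.IsGloballyMinimal] [NeZero (W.conductorNorm ℤ)],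
      ¬ W.HasCM → W.analyticRank = 1 → Nat.card (W.selmerGroup 2) = 2 → W.Δ < 0 →
      ∀ (K : Type) [Field K] [NumberField K], IsImaginaryQuadratic K →
        ∀ (ℓ : ℕ) [Fact ℓ.Prime], NumberField.discr K = -(ℓ : ℤ) → ¬ W.selmerGroup 2 ≤ MazurRubin2010.strictLocalKer W ℚ_[ℓ] 2 →
        Odd (NumberField.discr K) → NumberField.discr K ≠ -3 → SatisfiesHeegnerHypothesis (W.conductorNorm ℤ) K →
        ((Ideal.span {(2 : ℤ)}).primesOver (𝓞 K)).ncard = 2 →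
        (W.quadraticTwist (NumberField.discr K : ℚ)).entireLFunction 1 ≠ 0 →
        ∀ (Dt : ModularParametrizationData W (W.conductorNorm ℤ)) (β : ℤ) (ι : K →+* ℂ) (d₁ : KolyvaginHeegnerData Dt β ι 1),
          (∃ Q : (W.baseChange (ringClassField K ι 1)).toAffine.Point,
            ((2 ^ (padicValInt 2 Dt.c + padicValNat 2 W.tamagawaProduct) : ℕ) : ℤ) • Q = d₁.derivedPoint) ∧
          (¬ ∃ Q : (W.baseChange (ringClassField K ι 1)).toAffine.Point,
            ((2 ^ (padicValInt 2 Dt.c + padicValNat 2 W.tamagawaProduct + 1) : ℕ) : ℤ) • Q = d₁.derivedPoint))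
    (hGZ : GrossZagierAllLevels) (hGZK : MultPublishedInputsAtTwo) (hL : EntireLFunctionRat) (hMi : MilneAnyModel)
    (hMP : nonempty_modularParametrizationData) :
    ∀ (W : WeierstrassCurve ℚ) [W.IsElliptic] [W.IsGloballyMinimal], ¬ W.HasCM → W.analyticRank = 1 →
      Nat.card (W.selmerGroup 2) = 2 → W.Δ < 0 → BSDp W 2 :=
  bsdp_negDisc_of_wall_of_converse_of_exponent_of_facts hGZ hGZK hL hMi hMP (minimalRankZeroBSDTwo_of_wallItems hOrd hMult hSS hAdd)
    (rankZeroTwoConverse_of_items_of_offSemistable hC0g hC0m hC0r) hEXPneg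

/-! ## §2 The item is EQUIVALENT to its `Δ > 0` residual OFF′ modulo named inputs + EXP±_all -/

/-- **U₂ ⟺ OFF′ modulo WALL + CONV₀ + EXP⁻_all + EXP⁺_all + S_id + PRINT.**  With the four WALL items, the two rank-0 2-converse items + the off-semistable
converse residual, the two exponent texts EXP⁻_all / EXP⁺_all, the item S_id = stmt-32821 `RankOneAtTwoBigImageIdLocus` (BY NAME), the four print items and
BCDT as hypotheses, the crux `MinimalTwinBSDTwo` is EQUIVALENT to OFF′ := «non-CM, `r_an = 1`, `#Sel₂ = 2`, `Δ > 0`, and (`ρ̄_{W,2}` not onto ∨ (`¬MeetsEgg`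
∧ ¬(`ord₂ C = 0` ∧ `ρ̄_{W,2ⁿ}` onto ∀ n))) ⟹ BSD₂» — the two-transposition / square-discriminant territory.  (⟹ is restriction; ⟸ is the LINE 23 v1.8
composition: `Δ < 0` by §1, the egg by `AllDepth.bsdp_posDisc_egg_…`, the depth-0 identity locus with full 2-adic image by the S_id bridge
`Ledger.Line25.hTw0idSharp_of_idLocus_of_GZK`.)  CONDITIONAL on the displayed hypotheses; proves nothing about BSD; closes nothing.
[cite: Kramer1981, §2 Props. 3, 6] [cite: MazurRubin2010, Cor. 3.4 (i)] [cite: GrossZagier1986, V.§2 (2.2)] [cite: Miller2011LMS, Def. 1.1] -/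
theorem minimalTwinBSDTwo_iff_offPrime_of_items
    (hOrd : GoodOrdinaryRankZeroAtTwo) (hMult : MultiplicativeRankZeroAtTwo) (hSS : SupersingularRankZeroAtTwo) (hAdd : AdditiveRankZeroAtTwo)
    (hC0g : GoodOrdinaryRankZeroTwoConverse) (hC0m : MultiplicativeRankZeroTwoConverse)
    (hC0r : ∀ (V : WeierstrassCurve ℚ) [V.IsElliptic] [V.IsGloballyMinimal], ¬ V.HasCM → ¬ (GoodOrd V 2 ∨ Mult V 2) →
      V.selmerCorank 2 = 0 → V.analyticRank = 0)
    (hEXPneg : ∀ (W : WeierstrassCurve ℚ) [W.IsElliptic] [W.IsGloballyMinimal] [NeZero (W.conductorNorm ℤ)],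
      ¬ W.HasCM → W.analyticRank = 1 → Nat.card (W.selmerGroup 2) = 2 → W.Δ < 0 →
      ∀ (K : Type) [Field K] [NumberField K], IsImaginaryQuadratic K →
        ∀ (ℓ : ℕ) [Fact ℓ.Prime], NumberField.discr K = -(ℓ : ℤ) → ¬ W.selmerGroup 2 ≤ MazurRubin2010.strictLocalKer W ℚ_[ℓ] 2 →
        Odd (NumberField.discr K) → NumberField.discr K ≠ -3 → SatisfiesHeegnerHypothesis (W.conductorNorm ℤ) K →
        ((Ideal.span {(2 : ℤ)}).primesOver (𝓞 K)).ncard = 2 →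
        (W.quadraticTwist (NumberField.discr K : ℚ)).entireLFunction 1 ≠ 0 →
        ∀ (Dt : ModularParametrizationData W (W.conductorNorm ℤ)) (β : ℤ) (ι : K →+* ℂ) (d₁ : KolyvaginHeegnerData Dt β ι 1),
          (∃ Q : (W.baseChange (ringClassField K ι 1)).toAffine.Point,
            ((2 ^ (padicValInt 2 Dt.c + padicValNat 2 W.tamagawaProduct) : ℕ) : ℤ) • Q = d₁.derivedPoint) ∧
          (¬ ∃ Q : (W.baseChange (ringClassField K ι 1)).toAffine.Point,
            ((2 ^ (padicValInt 2 Dt.c + padicValNat 2 W.tamagawaProduct + 1) : ℕ) : ℤ) • Q = d₁.derivedPoint))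
    (hEXPpos : ∀ (W : WeierstrassCurve ℚ) [W.IsElliptic] [W.IsGloballyMinimal] [NeZero (W.conductorNorm ℤ)],
      ¬ W.HasCM → W.analyticRank = 1 → Nat.card (W.selmerGroup 2) = 2 → W.HasSurjectiveModNGaloisRep 2 → 0 < W.Δ → MeetsEgg W →
      ∀ (K : Type) [Field K] [NumberField K], IsImaginaryQuadratic K →
        ∀ (ℓ : ℕ), ℓ.Prime → NumberField.discr K = -(ℓ : ℤ) →
        (∀ x : ZMod ℓ, 4 * x ^ 3 + ((integralModelInt W).b₂ : ZMod ℓ) * x ^ 2 +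
            2 * ((integralModelInt W).b₄ : ZMod ℓ) * x + ((integralModelInt W).b₆ : ZMod ℓ) ≠ 0) →
        Odd (NumberField.discr K) → NumberField.discr K ≠ -3 → SatisfiesHeegnerHypothesis (W.conductorNorm ℤ) K →
        (W.quadraticTwist (NumberField.discr K : ℚ)).entireLFunction 1 ≠ 0 →
        ∀ (Dt : ModularParametrizationData W (W.conductorNorm ℤ)) (β : ℤ) (ι : K →+* ℂ) (d₁ : KolyvaginHeegnerData Dt β ι 1),
          (∃ Q : (W.baseChange (ringClassField K ι 1)).toAffine.Point,
            ((2 ^ (padicValInt 2 Dt.c + padicValNat 2 W.tamagawaProduct) : ℕ) : ℤ) • Q = d₁.derivedPoint) ∧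
          (¬ ∃ Q : (W.baseChange (ringClassField K ι 1)).toAffine.Point,
            ((2 ^ (padicValInt 2 Dt.c + padicValNat 2 W.tamagawaProduct + 1) : ℕ) : ℤ) • Q = d₁.derivedPoint))
    (hSid : RankOneAtTwoBigImageIdLocus)
    (hGZ : GrossZagierAllLevels) (hGZK : MultPublishedInputsAtTwo) (hL : EntireLFunctionRat) (hMi : MilneAnyModel)
    (hMP : nonempty_modularParametrizationData) :
    MinimalTwinBSDTwo ↔
      ∀ (W : WeierstrassCurve ℚ) [W.IsElliptic] [W.IsGloballyMinimal],
        ¬ W.HasCM → W.analyticRank = 1 → Nat.card (W.selmerGroup 2) = 2 → 0 < W.Δ →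
          (¬ W.HasSurjectiveModNGaloisRep 2 ∨
            (¬ MeetsEgg W ∧ ¬ (padicValNat 2 W.tamagawaProduct = 0 ∧ ∀ n : ℕ, W.HasSurjectiveModNGaloisRep ((2 ^ n : ℕ) : ℤ)))) →
          BSDp W 2 := by
  have h1 := minimalRankZeroBSDTwo_of_wallItems hOrd hMult hSS hAdd
  have hC0 := rankZeroTwoConverse_of_items_of_offSemistable hC0g hC0m hC0r
  refine ⟨fun h W _ _ hcm hr hSel _ _ ↦ h W hcm hr hSel, fun hRes W _ _ hcm hr hSel ↦ ?_⟩
  have hΔ : W.Δ ≠ 0 := by rw [← WeierstrassCurve.coe_Δ']; exact W.Δ'.ne_zero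
  rcases lt_or_gt_of_ne hΔ with hneg | hpos
  · exact bsdp_negDisc_of_wall_of_converse_of_exponent_of_facts hGZ hGZK hL hMi hMP h1 hC0 hEXPneg W hcm hr hSel hneg
  · by_cases hs : W.HasSurjectiveModNGaloisRep 2
    · by_cases hegg : MeetsEgg W
      · exact bsdp_posDisc_egg_of_wall_of_converse_of_exponent_of_facts hGZ hGZK hL hMi hMP h1 hC0 hEXPpos W hcm hr hSel hs hpos hegg
      · by_cases hid : padicValNat 2 W.tamagawaProduct = 0 ∧ ∀ n : ℕ, W.HasSurjectiveModNGaloisRep ((2 ^ n : ℕ) : ℤ)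
        · exact hTw0idSharp_of_idLocus_of_GZK hGZK hSid W hcm hr hSel hid.2 hpos hid.1 hegg
        · exact hRes W hcm hr hSel hpos (Or.inr ⟨hegg, hid⟩)
    · exact hRes W hcm hr hSel hpos (Or.inl hs)

end Summit.BirchSwinnertonDyer.BirchSwinnertonDyer.Theorems.GenusExact.TwinSwap.AllDepth

end
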